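import Summits.ResolutionOfSingularities.ResolutionOfSingularities.Theorems.HilbertSamuelEliminationSigmaMaxModificationsCorridor3WLadderMovingTwoLocDefs
import Summits.ResolutionOfSingularities.ResolutionOfSingularities.Theorems.HilbertSamuelEliminationSigmaMaxModificationsCorridor3WLadderSegmentsExtractFree
import Summits.ResolutionOfSingularities.ResolutionOfSingularities.Theorems.HilbertSamuelEliminationSigmaMaxModificationsCorridor3WLadderIsoLowFreeBridge
import Summits.ResolutionOfSingularities.ResolutionOfSingularities.Theorems.HilbertSamuelEliminationSigmaMaxModificationsCorridor3WLadderStrataNearFibreGeomDir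
import HarnessLib

/-!
# [OURS · L1 W4.2] Row `stub_Wlow3M_two` in the UNITS MODEL OF RECORD (b): assembly through the unit-wise localised key theorem, and
# THE ONE-STATEMENT CENSUS of the characteristic-2 row with every construction discharged that the tree discharges today
# (crux chain w42, line `w_ladder` v7; CHAIN v3.14 «stub-3 β assembly by name (hB discharged)»; `--supports stmt-…-19249`, helper)

Stub worker res-L1-w42-stub-3 (gen 3). Over `…MovingTwoLocDefs` (`KeyTheorem640_localized_isolated`, `UnitTowerExtractionLocFreeM`):

* `keyTheorem640_char_localized_isolated_of_free` — the OURS claim implies the printed F-04c carrier (drop (F1));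
* `unitTowerExtractionLocFreeM_of_recognition` — the model-(b) extraction at ALL origins from stub-1's recognition row
  `Seg.UnitRecognitionAtQM p ⊤` (his `unitTowerExtractionLocFree_of_recognition`, characteristic-free, Q-generic);
* `wlowUnitsM_of_extractionLocFree`, `wlowM_assembled_locFree` — units-half / `WlowM p` in model (b), every prime, every origin;
* **`wlow3TwoM_of_residue_loc`** — the (H-β) theorem in model (b): `∀ p, p.Prime → Wlow3TwoM p` from
  {`KeyTheorem640_localized_isolated`, `Corollary637_geomDir`} (R_β, model (b)), the shadow `Theorem314_geomDir`, and the constructions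
  `IsoE1BridgeFreeM 2`, `UnitTowerExtractionLocFreeM 2`, `WlowStrataM 2`;
* **`wlow3TwoM_census`** — THE ROW'S ONE-STATEMENT CENSUS TODAY: with stub-2's β-port (`isoE1BridgeFreeM_of_facts`,
  `thm314_point_locus_geomDir_of_sharp`), res-type-001's 2.14♯ (`Directrix214Sharp.directrix_nearPoint_of_geomDirDim_le` from the printed
  F14–F16), stub-1's characteristic-free extraction and stub-4's regime-free strata row plugged in, the registered stub follows from:
  PRINTED {CJS Thm. 3.10 (4), Thm. 3.14 point form `Thm314_point_locus`, `ProjDir_line`, [H4] Th. IV `Hironaka1970_thmIV_point`,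
  [H5] Th. 1 cor. `Hironaka1970_thm1_cor`, Mizutani 2.8 `Mizutani1973_vectorGroup_of_dim_le`}; OURS CLAIMS {`KeyTheorem640_localized_isolated`,
  `Corollary637_geomDir`} (R_β); (F1♯) SHADOWS {`Theorem314_geomDir`, `Theorem314_nearFibre_geomDir`} (full-centre 2.14♯, T7b in flight);
  OURS CONSTRUCTIONS {`Seg.UnitRecognitionAtQM 2 ⊤` (unit recognition), `StrataLineageInCentreIO` / `StrataCycleStartRegular` at
  `(2, 3, QNe ⊤, ē ≤ 2)` ((c-geo)/(c-reg))}. CONDITIONAL — credits nothing.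

OURS (cell res-hironaka, slot W4.2); NOT statements of the manuscript [Hironaka2017] nor of [CossartJannsenSaito2020];
AI-drafted, weaker than expert review. References: CJS LNM 2270 Thm. 3.10 (4), Thm. 3.14, Def. 6.34, Thm. 6.35, Cor. 6.37, Def. 6.38/6.39,
Thm. 6.40, p. 107 [CossartJannsenSaito2020]; H. Hironaka, J. Math. Kyoto Univ. 10 (1970) Th. IV; Ann. Math. 92 (1970) Th. 1;
H. Mizutani, Nagoya Math. J. 52 (1973) Thm. 2.8 [Mizutani1973HironakaGroupSchemes]; CHAIN v3.14.
-/

noncomputable section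

-- namespace `…Corridor3.Moving` re-enters `…Corridor3` (module convention of the Moving files)
set_option linter.dupNamespace false

open CategoryTheory AlgebraicGeometry TopologicalSpace IsLocalRing
open Literature.AlgebraicGeometry.Resolution Literature.AlgebraicGeometry.Resolution.HironakaScheme
open Literature.RingTheory.HilbertSamuel
open Summit.ResolutionOfSingularities.ResolutionOfSingularities.Theorems.CampaignW42
open Literature.AlgebraicGeometry.CossartJannsenSaito2020
open Summit.ResolutionOfSingularities.ResolutionOfSingularities.Theses.HilbertSamuelElimination
open Summit.ResolutionOfSingularities.ResolutionOfSingularities.Theorems.SigmaMaxModificationsCorridor3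

namespace Summit.ResolutionOfSingularities.ResolutionOfSingularities.Theorems.SigmaMaxModificationsCorridor3.Moving

/-! ## The model-(b) carrier against print, and the extraction from recognition -/

/-- The OURS claim `KeyTheorem640_localized_isolated` implies the printed F-04c carrier `KeyTheorem640_char_localized_isolated`
(drop the characteristic hypothesis). [folklore] -/
theorem keyTheorem640_char_localized_isolated_of_free (h : KeyTheorem640_localized_isolated.{0}) :
    KeyTheorem640_char_localized_isolated.{0} :=
  fun T N len pt tpt hset _ hchain hiso => h T N len pt tpt hset hchain hiso

/-- **`UnitTowerExtractionLocFreeM p` FROM THE RECOGNITION ROW at all origins** (stub-1's characteristic-free `Q`-generic extraction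
`unitTowerExtractionLocFree_of_recognition` at `Q = ⊤`). [cite: CossartJannsenSaito2020, Def. 6.38, Def. 6.39, p. 107] -/
theorem unitTowerExtractionLocFreeM_of_recognition {p : ℕ} (hrec : Seg.UnitRecognitionAtQM p fun _ _ _ _ => True) :
    UnitTowerExtractionLocFreeM p :=
  fun R hRf hRa ν X _ x hX c h0 hstep hG hmov hIso h22 =>
    unitTowerExtractionLocFree_of_recognition p _ hrec R hRf hRa ν X x hX trivial c h0 hstep hG hmov hIso h22

/-! ## Units-half and `WlowM` in model (b), every prime, every origin -/

/-- **UNITS-half `WlowUnitsM p` in model (b)**: `KeyTheorem640_localized_isolated` + the socket `IsoLowDirDimTerminatesFreeM p` +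
`UnitTowerExtractionLocFreeM p` (the proof of `wlowUnitsM_of_extraction_freeSocket` with the localised key).
[cite: CossartJannsenSaito2020, Thm. 6.40, Cor. 6.37, p. 107] -/
theorem wlowUnitsM_of_extractionLocFree {p : ℕ} (hK : KeyTheorem640_localized_isolated.{0}) (hlow : IsoLowDirDimTerminatesFreeM p)
    (hext : UnitTowerExtractionLocFreeM p) : WlowUnitsM p := by
  intro R hRf hRa ν X _ x hX
  rintro ⟨c, h0, hstep, hG, hmov, hrec⟩
  by_cases hlowstage : ∃ m, Iso 3 (c m) ∧ dirDim (c m) ≤ 1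
  · obtain ⟨m, hiso, hdir⟩ := hlowstage
    exact hlow R hRf hRa ν X x hX (c m) (reaches_chain h0 hstep m) hiso hdir (hG m)
      ⟨fun n => c (m + n), Relation.ReflTransGen.refl, fun n => hstep (m + n), fun n => hG (m + n), io_shift hmov m⟩
  · push Not at hlowstage
    have he : ∀ n, Iso 3 (c n) → dirDim (c n) = 2 ∧ (c n).geomDirDim = 2 := by
      intro n hiso
      have h1 := hlowstage n hiso
      have h2 := dirDim_le_geomDirDim (c n)
      have h3 := hG n
      exact ⟨by omega, by omega⟩
    obtain ⟨T, len, pt, tpt, hchain, hset, hisoT⟩ := hext R hRf hRa ν X x hX c h0 hstep hG hmov hrec he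
    exact hK T 3 len pt tpt hset hchain hisoT

/-- **`WlowM p` in model (b)** (+ the strata-half). [cite: CossartJannsenSaito2020, Thm. 6.40, Cor. 6.37, Thm. 6.35] -/
theorem wlowM_assembled_locFree {p : ℕ} (hK : KeyTheorem640_localized_isolated.{0}) (hlow : IsoLowDirDimTerminatesFreeM p)
    (hext : UnitTowerExtractionLocFreeM p) (hS : WlowStrataM p) : WlowM p :=
  maxOriginNoMovingNearChainAt_of_recurrence hS (wlowUnitsM_of_extractionLocFree hK hlow hext)

/-! ## The (H-β) theorem in model (b) -/

/-- **THE CHARACTERISTIC-2 ROW FROM ITS RESIDUE, MODEL (b).** `∀ p, p.Prime → Wlow3TwoM p` from the OURS claims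
`KeyTheorem640_localized_isolated`, `Corollary637_geomDir`, the (F1♯)-shadow `Theorem314_geomDir`, and the OURS constructions
`IsoE1BridgeFreeM 2`, `UnitTowerExtractionLocFreeM 2`, `WlowStrataM 2`. [folklore] -/
theorem wlow3TwoM_of_residue_loc (hK : KeyTheorem640_localized_isolated.{0}) (hC : Corollary637_geomDir.{0})
    (hF : Theorem314_geomDir.{0}) (hB : IsoE1BridgeFreeM 2) (hU : UnitTowerExtractionLocFreeM 2) (hS : WlowStrataM 2) :
    ∀ p : ℕ, p.Prime → Wlow3TwoM.{0} p :=
  stub_Wlow3M_two_of_two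
    (wlow3TwoM_of_wlowM (wlowM_assembled_locFree hK (isoLowDirDimTerminatesFreeM_of_bridge hF hC hB) hU hS))

/-! ## The row's one-statement census today -/

/-- **THE CHARACTERISTIC-2 ROW `stub_Wlow3M_two`: ONE-STATEMENT CENSUS (2026-08-27), every construction discharged that the tree
discharges.** The registered stub `∀ p, p.Prime → Wlow3TwoM p` follows from:
PRINTED — CJS Thm. 3.10 (4) `CossartJannsenSaito2020_thm_3_10_4`, Thm. 3.14 point form `Thm314_point_locus`, `ProjDir_line`
(Def. 6.34 (i) at `e = 1`), [H4] Th. IV `Hironaka1970_thmIV_point`, [H5] Th. 1 cor. `Hironaka1970_thm1_cor`, Mizutani 2.8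
`Mizutani1973_vectorGroup_of_dim_le`; OURS CLAIMS (R_β) — `KeyTheorem640_localized_isolated`, `Corollary637_geomDir`;
(F1♯) SHADOWS of the full-centre directrix theorem — `Theorem314_geomDir`, `Theorem314_nearFibre_geomDir`;
OURS CONSTRUCTIONS — unit recognition `Seg.UnitRecognitionAtQM 2 ⊤`, (c-geo) `StrataLineageInCentreIO`, (c-reg)
`StrataCycleStartRegular` (at `p = 2`, level `3`, origins `QNe ⊤`, grade `ē ≤ 2`). Plugs: stub-2's `isoE1BridgeFreeM_of_facts` /
`thm314_point_locus_geomDir_of_sharp`, res-type-001's `Directrix214Sharp.directrix_nearPoint_of_geomDirDim_le`, stub-1's extraction,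
stub-4's `wlowStrataM_of_geomDir_centreIO_cycleStartRegular`. CONDITIONAL — credits nothing; it is the row's honest residue as ONE checkable
statement. [cite: CossartJannsenSaito2020, Thm. 3.10 (4), Thm. 3.14, Def. 6.34, Thm. 6.35, Cor. 6.37, Def. 6.38, Thm. 6.40] -/
theorem wlow3TwoM_census
    (h3104 : CossartJannsenSaito2020_thm_3_10_4.{0}) (h314pt : Thm314_point_locus.{0}) (hline : ProjDir_line.{0})
    (h14 : Hironaka1970_thmIV_point.{0}) (h15 : ∀ (q : ℕ) [Fact q.Prime], Hironaka1970_thm1_cor.{0} q)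
    (h16 : ∀ (q : ℕ) [Fact q.Prime], Mizutani1973_vectorGroup_of_dim_le.{0} q)
    (hK : KeyTheorem640_localized_isolated.{0}) (hC : Corollary637_geomDir.{0})
    (hF : Theorem314_geomDir.{0}) (hFf : Theorem314_nearFibre_geomDir.{0})
    (hrec : Seg.UnitRecognitionAtQM 2 fun _ _ _ _ => True)
    (hgeo : StrataLineageInCentreIO.{0} 2 3 (QNe fun _ _ _ _ => True) fun s => s.geomDirDim ≤ 2)
    (hreg : StrataCycleStartRegular.{0} 2 3 (QNe fun _ _ _ _ => True) fun s => s.geomDirDim ≤ 2) :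
    ∀ p : ℕ, p.Prime → Wlow3TwoM.{0} p :=
  wlow3TwoM_of_residue_loc hK hC hF
    (isoE1BridgeFreeM_of_facts hF h3104
      (thm314_point_locus_geomDir_of_sharp (Directrix214Sharp.directrix_nearPoint_of_geomDirDim_le h14 h15 h16) h314pt) hline 2)
    (unitTowerExtractionLocFreeM_of_recognition hrec)
    (wlowStrataM_of_geomDir_centreIO_cycleStartRegular hF hFf hgeo hreg)

end Summit.ResolutionOfSingularities.ResolutionOfSingularities.Theorems.SigmaMaxModificationsCorridor3.Moving

end
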